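import Mathlib
import HarnessLib
import Summits.RiemannHypothesis.RiemannHypothesis.Theorems.IntegerScrewParityGap

/-!
# Route `IntegerScrew` — inputs for the TWO-RUNG theorem (`IntegerScrewWalkTwoLevels`): the sharp UPPER bound for the
# blocked-birth defect, its bounded harmonic mass, and the Gram entries / means of the parity functions `φ₂`, `φ₃`

* `sum_Icc_dvd_vonMangoldt_div_ge_sharp`, `parityDefect_eq` (the defect is EXACTLY `(log p/(p−1))p^{−⌊log_p y⌋}`), **`parityDefect_le_sharp`** — `r_p(y) = log p/(p−1) − Σ_{n≤y, p|n}Λ(n)/n ≤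
  (log p/(p−1))·p/(y+1)` (the defect is exactly `(log p/(p−1))p^{−⌊log_p y⌋}`);
* **`sum_parityDefect_div_le`** — `Σ_{k ≤ M} r_p(⌊M/k⌋)/k ≤ λ_p = p log p/(p−1)` (bounded harmonic mass of the defect);
* `sum_parityFun_div_eq` (`π`-mean `(H_M − H_{⌊M/p⌋})/p`), `sum_parityFun_div_sq_le_one`, `sum_parityFun_two_sq_div`
  (`‖φ₂‖² = H_M/4`), `sum_parityFun_three_sq_div_ge` (`‖φ₃‖² ≥ H_M/9`), `sum_parityFun_two_mul_three_div`
  (`⟨φ₂,φ₃⟩_π = (H_M − H_{⌊M/2⌋} − H_{⌊M/3⌋} + H_{⌊M/6⌋})/6`), `abs_sum_parityFun_two_mul_three_div_le` (`|⟨φ₂,φ₃⟩_π| ≤ 1/3`);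
* for the K-rung extension (general coprime `p, q`): `harmonic_sub_harmonic_div_bounds` (`0 ≤ H_M − H_{⌊M/p⌋} ≤ 1 + log p`),
  `sum_parityFun_mul_div` (`⟨φ_p,φ_q⟩_π` in closed form), `abs_sum_parityFun_mul_div_le` (`≤ (1 + log p)/(pq)`),
  `sum_parityFun_sq_div_ge` (`‖φ_p‖² ≥ H_M/p²`).

RH-free.  References: PIVOT-LAW §13.10 (iv), CONTINUUM-LIMIT §23.18 (rh-explicit A6-PIVOT); M. Suzuki, J. Lond. Math.
Soc. (2) 108 (2023) 1448–1487 [Suzuki2023].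
-/

noncomputable section

set_option linter.dupNamespace false -- D-0017: `Summit.<S>.<S>.…` is the designed namespace

namespace Summit.RiemannHypothesis.RiemannHypothesis.Theorems.IntegerScrew

open Finset ArithmeticFunction

/-! ### The sharp UPPER bound for the blocked-birth defect -/

/-- `Σ_{n ≤ y, p ∣ n} Λ(n)/n ≥ (log p/(p−1))·(1 − p^{−⌊log_p y⌋})`: the powers `p, …, p^{⌊log_p y⌋}` all contribute. -/
theorem sum_Icc_dvd_vonMangoldt_div_ge_sharp {p : ℕ} (hp : p.Prime) (y : ℕ) :
    Real.log p / ((p : ℝ) - 1) * (1 - ((p : ℝ) ^ Nat.log p y)⁻¹) ≤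
      ∑ n ∈ (Icc 1 y).filter (fun n => p ∣ n), Λ n / n := by
  have hp1 : (1 : ℝ) < p := by exact_mod_cast hp.one_lt
  have hp0 : (0 : ℝ) < p := by linarith
  set A := Nat.log p y with hA
  have hinj : Set.InjOn (fun a => p ^ (a + 1)) (Finset.range A : Set ℕ) := by
    intro a _ b _ h
    have := Nat.pow_right_injective hp.two_le h
    omega
  have hsub : (Finset.range A).image (fun a => p ^ (a + 1)) ⊆ (Icc 1 y).filter (fun n => p ∣ n) := by
    intro n hn
    obtain ⟨a, ha, rfl⟩ := Finset.mem_image.1 hn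
    have ha' := Finset.mem_range.1 ha
    have hy0 : y ≠ 0 := by
      intro h; rw [h, Nat.log_zero_right] at hA; omega
    rw [Finset.mem_filter, Finset.mem_Icc]
    refine ⟨⟨Nat.one_le_pow _ _ hp.pos, ?_⟩, dvd_pow_self p (Nat.succ_ne_zero a)⟩
    calc p ^ (a + 1) ≤ p ^ A := Nat.pow_le_pow_right hp.pos (by omega)
      _ ≤ y := by rw [hA]; exact Nat.pow_log_le_self p hy0
  have hterm : ∀ a ∈ Finset.range A,
      Λ (p ^ (a + 1)) / ((p ^ (a + 1) : ℕ) : ℝ) = Real.log p * ((p : ℝ)⁻¹ * (p : ℝ)⁻¹ ^ a) := by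
    intro a _
    rw [vonMangoldt_apply_pow (Nat.succ_ne_zero a), vonMangoldt_apply_prime hp, Nat.cast_pow, ← pow_succ',
      inv_pow, div_eq_mul_inv]
  have hT : ∑ n ∈ (Finset.range A).image (fun a => p ^ (a + 1)), Λ n / (n : ℝ) =
      Real.log p / ((p : ℝ) - 1) * (1 - ((p : ℝ) ^ A)⁻¹) := by
    rw [Finset.sum_image hinj, Finset.sum_congr rfl hterm, ← Finset.mul_sum, ← Finset.mul_sum,
      geom_sum_eq (inv_ne_one.2 hp1.ne')]
    have hp1' : (p : ℝ) - 1 ≠ 0 := by linarith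
    have h1p : (1 : ℝ) - p ≠ 0 := by linarith
    have e1 : (p : ℝ)⁻¹ - 1 = (1 - p) / p := by field_simp
    rw [e1, inv_pow]
    field_simp
    ring
  rw [← hT]
  exact Finset.sum_le_sum_of_subset_of_nonneg hsub fun n _ _ => div_nonneg vonMangoldt_nonneg (Nat.cast_nonneg n)

/-- **The blocked-birth defect exactly**: `r_p(y) = log p/(p−1) − Σ_{n≤y, p|n}Λ(n)/n = (log p/(p−1))·p^{−⌊log_p y⌋}`
(CONTINUUM-LIMIT 23.18 (f): on the band `p^a ≤ ⌊M/x⌋ < p^{a+1}` the defect is `(log p)p^{−a}/(p−1)`). -/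
theorem parityDefect_eq {p : ℕ} (hp : p.Prime) (y : ℕ) :
    Real.log p / ((p : ℝ) - 1) - ∑ n ∈ (Icc 1 y).filter (fun n => p ∣ n), Λ n / n =
      Real.log p / ((p : ℝ) - 1) * ((p : ℝ) ^ Nat.log p y)⁻¹ := by
  have h1 := sum_Icc_dvd_vonMangoldt_div_le_sharp hp y
  have h2 := sum_Icc_dvd_vonMangoldt_div_ge_sharp hp y
  have e : ∑ n ∈ (Icc 1 y).filter (fun n => p ∣ n), Λ n / (n : ℝ) =
      Real.log p / ((p : ℝ) - 1) * (1 - ((p : ℝ) ^ Nat.log p y)⁻¹) := le_antisymm h1 h2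
  rw [e]; ring

/-- **Sharp defect upper bound**: `r_p(y) = log p/(p−1) − Σ_{n ≤ y, p ∣ n}Λ(n)/n ≤ (log p/(p−1))·p/(y+1)`
(the defect is exactly `(log p/(p−1))p^{−⌊log_p y⌋}` and `p^{⌊log_p y⌋+1} > y`). -/
theorem parityDefect_le_sharp {p : ℕ} (hp : p.Prime) (y : ℕ) :
    Real.log p / ((p : ℝ) - 1) - ∑ n ∈ (Icc 1 y).filter (fun n => p ∣ n), Λ n / n ≤
      Real.log p / ((p : ℝ) - 1) * ((p : ℝ) / ((y : ℝ) + 1)) := by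
  have hp1 : (1 : ℝ) < p := by exact_mod_cast hp.one_lt
  have hp0 : (0 : ℝ) < p := by linarith
  have hc : 0 ≤ Real.log p / ((p : ℝ) - 1) := div_nonneg (Real.log_nonneg hp1.le) (by linarith)
  have h := sum_Icc_dvd_vonMangoldt_div_ge_sharp hp y
  -- (p^A)⁻¹ ≤ p/(y+1) since y + 1 ≤ p^(A+1)
  have hA : ((p : ℝ) ^ Nat.log p y)⁻¹ ≤ (p : ℝ) / ((y : ℝ) + 1) := by
    have hy : (y : ℝ) + 1 ≤ (p : ℝ) ^ (Nat.log p y + 1) := by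
      exact_mod_cast Nat.lt_pow_succ_log_self hp.one_lt y
    rw [inv_eq_one_div, div_le_div_iff₀ (by positivity) (by positivity), one_mul, ← pow_succ']
    exact hy
  calc Real.log p / ((p : ℝ) - 1) - ∑ n ∈ (Icc 1 y).filter (fun n => p ∣ n), Λ n / n
      ≤ Real.log p / ((p : ℝ) - 1) * ((p : ℝ) ^ Nat.log p y)⁻¹ := by linarith
    _ ≤ Real.log p / ((p : ℝ) - 1) * ((p : ℝ) / ((y : ℝ) + 1)) := mul_le_mul_of_nonneg_left hA hc

/-- **The blocked-birth defect has bounded harmonic mass**: `Σ_{k ≤ M} r_p(⌊M/k⌋)/k ≤ p log p/(p−1) = λ_p`. -/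
theorem sum_parityDefect_div_le {p : ℕ} (hp : p.Prime) {M : ℕ} (hM : 1 ≤ M) :
    ∑ k ∈ Icc 1 M, (Real.log p / ((p : ℝ) - 1) -
        ∑ n ∈ (Icc 1 (M / k)).filter (fun n => p ∣ n), Λ n / n) / k ≤
      (p : ℝ) * Real.log p / ((p : ℝ) - 1) := by
  have hp1 : (1 : ℝ) < p := by exact_mod_cast hp.one_lt
  have hM0 : (0 : ℝ) < M := by exact_mod_cast hM
  have hc : 0 ≤ Real.log p / ((p : ℝ) - 1) := div_nonneg (Real.log_nonneg hp1.le) (by linarith)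
  have hterm : ∀ k ∈ Icc 1 M, (Real.log p / ((p : ℝ) - 1) -
      ∑ n ∈ (Icc 1 (M / k)).filter (fun n => p ∣ n), Λ n / n) / k ≤ (p : ℝ) * Real.log p / ((p : ℝ) - 1) / M := by
    intro k hk
    have hk1 : 1 ≤ k := (Finset.mem_Icc.1 hk).1
    have hk0 : (0 : ℝ) < k := by exact_mod_cast hk1
    have h1 := parityDefect_le_sharp hp (M / k)
    -- (M/k : ℕ) + 1 > M/k, so p/((M/k)+1) ≤ p·k/M
    have hfl : (M : ℝ) / k ≤ ((M / k : ℕ) : ℝ) + 1 := by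
      have h := Nat.lt_div_mul_add (a := M) (show 0 < k by omega)
      have h' : (M : ℝ) < ((M / k : ℕ) : ℝ) * k + k := by exact_mod_cast h
      rw [div_le_iff₀ hk0]
      linarith
    have h2 : (p : ℝ) / (((M / k : ℕ) : ℝ) + 1) ≤ (p : ℝ) * k / M := by
      rw [div_le_div_iff₀ (by positivity) hM0]
      have := mul_le_mul_of_nonneg_left hfl (show (0 : ℝ) ≤ p * k by positivity)
      calc (p : ℝ) * M = (p : ℝ) * k * ((M : ℝ) / k) := by field_simp
        _ ≤ (p : ℝ) * k * (((M / k : ℕ) : ℝ) + 1) := this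
    rw [div_le_iff₀ hk0]
    calc Real.log p / ((p : ℝ) - 1) - ∑ n ∈ (Icc 1 (M / k)).filter (fun n => p ∣ n), Λ n / n
        ≤ Real.log p / ((p : ℝ) - 1) * ((p : ℝ) * k / M) := h1.trans (mul_le_mul_of_nonneg_left h2 hc)
      _ = (p : ℝ) * Real.log p / ((p : ℝ) - 1) / M * k := by field_simp
  refine (Finset.sum_le_sum hterm).trans ?_
  rw [Finset.sum_const, Nat.card_Icc, nsmul_eq_mul, Nat.add_sub_cancel]
  field_simp
  exact le_rfl

/-! ### Gram entries and means of `φ₂`, `φ₃` -/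

/-- The `π`-mean of `φ_p` in closed form: `Σ_{k ≤ M} φ_p(k)/k = (H_M − H_{⌊M/p⌋})/p`. -/
theorem sum_parityFun_div_eq {p : ℕ} (hp : 1 ≤ p) (M : ℕ) :
    ∑ k ∈ Icc 1 M, parityFun p k / (k : ℝ) =
      ((∑ k ∈ Icc 1 M, (1 : ℝ) / k) - ∑ n ∈ Icc 1 (M / p), (1 : ℝ) / n) / p := by
  have hp0 : (p : ℝ) ≠ 0 := by exact_mod_cast (show p ≠ 0 by omega)
  have e : ∀ k ∈ Icc 1 M, parityFun p k / (k : ℝ) =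
      (1 / (p : ℝ)) * (1 / (k : ℝ)) - (if p ∣ k then 1 / (k : ℝ) else 0) := by
    intro k _
    by_cases h : p ∣ k
    · rw [parityFun_of_dvd h, if_pos h]; field_simp; ring
    · rw [parityFun_of_not_dvd h, if_neg h]; ring
  rw [Finset.sum_congr rfl e, Finset.sum_sub_distrib, ← Finset.mul_sum, ← Finset.sum_filter,
    sum_inv_multiples_eq hp]
  field_simp

/-- `|π(φ_p)·| ≤ 1`: `0 ≤ Σ_{k ≤ M} φ_p(k)/k ≤ (1 + log p)/p ≤ 1` for a prime `p` and `M ≥ 1`. -/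
theorem sum_parityFun_div_sq_le_one {p : ℕ} (hp : p.Prime) {M : ℕ} (hM : 1 ≤ M) :
    (∑ k ∈ Icc 1 M, parityFun p k / (k : ℝ)) ^ 2 ≤ 1 := by
  have hp1 : 1 ≤ p := hp.one_lt.le
  have hpR : (1 : ℝ) < p := by exact_mod_cast hp.one_lt
  rw [sum_parityFun_div_eq hp1]
  set H : ℝ := ∑ k ∈ Icc 1 M, (1 : ℝ) / k with hH
  set H' : ℝ := ∑ n ∈ Icc 1 (M / p), (1 : ℝ) / n with hH'
  -- 0 ≤ H − H' ≤ 1 + log p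
  have hsub : Icc 1 (M / p) ⊆ Icc 1 M := Finset.Icc_subset_Icc_right (Nat.div_le_self M p)
  have hlo : 0 ≤ H - H' := by
    rw [hH, hH']
    linarith [Finset.sum_le_sum_of_subset_of_nonneg hsub (f := fun k : ℕ => (1 : ℝ) / k) fun k _ _ => by positivity]
  have hhi : H - H' ≤ 1 + Real.log p := by
    have h1 : H ≤ Real.log M + 1 := harmonicSum_le_log_add_one hM
    have h2 : Real.log (((M / p : ℕ) : ℝ) + 1) ≤ H' := log_succ_le_harmonicSum (M / p)
    have hM0 : (0 : ℝ) < M := by exact_mod_cast hM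
    -- M/p ≤ ⌊M/p⌋ + 1
    have hfl : (M : ℝ) / p ≤ ((M / p : ℕ) : ℝ) + 1 := by
      have h := Nat.lt_div_mul_add (a := M) hp.pos
      have h' : (M : ℝ) < ((M / p : ℕ) : ℝ) * p + p := by exact_mod_cast h
      rw [div_le_iff₀ (by linarith)]
      linarith
    have h3 : Real.log M - Real.log p ≤ Real.log (((M / p : ℕ) : ℝ) + 1) := by
      rw [← Real.log_div hM0.ne' (by linarith)]
      exact Real.log_le_log (by positivity) hfl
    linarith
  -- (1 + log p)/p ≤ 1 since log p ≤ p − 1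
  have hlp : Real.log p ≤ (p : ℝ) - 1 := by linarith [Real.log_le_sub_one_of_pos (by linarith : (0 : ℝ) < p)]
  have hq : 0 ≤ (H - H') / p := div_nonneg hlo (by linarith)
  have hq1 : (H - H') / p ≤ 1 := by rw [div_le_one (by linarith)]; linarith
  nlinarith

/-- `‖φ₂‖²_π = H_M/4`. -/
theorem sum_parityFun_two_sq_div (M : ℕ) :
    ∑ k ∈ Icc 1 M, parityFun 2 k ^ 2 / (k : ℝ) = (∑ k ∈ Icc 1 M, (1 : ℝ) / k) / 4 := by
  rw [Finset.sum_div]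
  refine Finset.sum_congr rfl fun k _ => ?_
  have hsq : parityFun 2 k ^ 2 = 1 / 4 := by
    by_cases h2 : 2 ∣ k
    · rw [parityFun_of_dvd h2]; norm_num
    · rw [parityFun_of_not_dvd h2]; norm_num
  rw [hsq]; ring

/-- `‖φ₃‖²_π ≥ H_M/9`. -/
theorem sum_parityFun_three_sq_div_ge (M : ℕ) :
    (∑ k ∈ Icc 1 M, (1 : ℝ) / k) / 9 ≤ ∑ k ∈ Icc 1 M, parityFun 3 k ^ 2 / (k : ℝ) := by
  rw [Finset.sum_div]
  refine Finset.sum_le_sum fun k _ => ?_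
  have hsq : 1 / 9 ≤ parityFun 3 k ^ 2 := by
    by_cases h3 : 3 ∣ k
    · rw [parityFun_of_dvd h3]; norm_num
    · rw [parityFun_of_not_dvd h3]; norm_num
  have hk : (0 : ℝ) ≤ 1 / (k : ℝ) := by positivity
  calc 1 / (k : ℝ) / 9 = 1 / 9 * (1 / (k : ℝ)) := by ring
    _ ≤ parityFun 3 k ^ 2 * (1 / (k : ℝ)) := mul_le_mul_of_nonneg_right hsq hk
    _ = parityFun 3 k ^ 2 / (k : ℝ) := by ring

/-- `⟨φ₂, φ₃⟩_π = (H_M − H_{⌊M/2⌋} − H_{⌊M/3⌋} + H_{⌊M/6⌋})/6` (from `φ₂φ₃ = 1/6 − 𝟙[2|k]/3 − 𝟙[3|k]/2 + 𝟙[6|k]`). -/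
theorem sum_parityFun_two_mul_three_div (M : ℕ) :
    ∑ k ∈ Icc 1 M, parityFun 2 k * parityFun 3 k / (k : ℝ) =
      ((∑ k ∈ Icc 1 M, (1 : ℝ) / k) - (∑ n ∈ Icc 1 (M / 2), (1 : ℝ) / n)
        - (∑ n ∈ Icc 1 (M / 3), (1 : ℝ) / n) + ∑ n ∈ Icc 1 (M / 6), (1 : ℝ) / n) / 6 := by
  have e : ∀ k ∈ Icc 1 M, parityFun 2 k * parityFun 3 k / (k : ℝ) =
      (1 / 6) * (1 / (k : ℝ)) - (1 / 3) * (if 2 ∣ k then 1 / (k : ℝ) else 0)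
        - (1 / 2) * (if 3 ∣ k then 1 / (k : ℝ) else 0) + (if 6 ∣ k then 1 / (k : ℝ) else 0) := by
    intro k _
    have h6 : 6 ∣ k ↔ 2 ∣ k ∧ 3 ∣ k := by
      constructor
      · intro h; exact ⟨(dvd_trans (by norm_num) h), (dvd_trans (by norm_num) h)⟩
      · rintro ⟨h2, h3⟩
        exact Nat.Coprime.mul_dvd_of_dvd_of_dvd (by norm_num : Nat.Coprime 2 3) h2 h3
    by_cases h2 : 2 ∣ k
    · by_cases h3 : 3 ∣ k
      · rw [parityFun_of_dvd h2, parityFun_of_dvd h3, if_pos h2, if_pos h3, if_pos (h6.2 ⟨h2, h3⟩)]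
        norm_num; ring
      · rw [parityFun_of_dvd h2, parityFun_of_not_dvd h3, if_pos h2, if_neg h3,
          if_neg (fun h => h3 (h6.1 h).2)]
        norm_num; ring
    · by_cases h3 : 3 ∣ k
      · rw [parityFun_of_not_dvd h2, parityFun_of_dvd h3, if_neg h2, if_pos h3,
          if_neg (fun h => h2 (h6.1 h).1)]
        norm_num; ring
      · rw [parityFun_of_not_dvd h2, parityFun_of_not_dvd h3, if_neg h2, if_neg h3,
          if_neg (fun h => h2 (h6.1 h).1)]
        ring
  rw [Finset.sum_congr rfl e]
  simp only [Finset.sum_add_distrib, Finset.sum_sub_distrib, ← Finset.mul_sum, ← Finset.sum_filter]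
  rw [sum_inv_multiples_eq (by norm_num : 1 ≤ 2), sum_inv_multiples_eq (by norm_num : 1 ≤ 3),
    sum_inv_multiples_eq (by norm_num : 1 ≤ 6)]
  push_cast
  ring

/-- `|⟨φ₂, φ₃⟩_π| ≤ 1/3` for `M ≥ 6` (`log(n+1) ≤ H_n ≤ log n + 1` and `log 2 + log 3 = log 6`). -/
theorem abs_sum_parityFun_two_mul_three_div_le {M : ℕ} (hM : 6 ≤ M) :
    |∑ k ∈ Icc 1 M, parityFun 2 k * parityFun 3 k / (k : ℝ)| ≤ 1 / 3 := by
  rw [sum_parityFun_two_mul_three_div]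
  have hM0 : (0 : ℝ) < M := by exact_mod_cast (show 0 < M by omega)
  -- floor bounds: M/q − 1 < ⌊M/q⌋ ≤ M/q, and ⌊M/q⌋ ≥ 1
  have hfl : ∀ q : ℕ, 0 < q → (M : ℝ) / q ≤ ((M / q : ℕ) : ℝ) + 1 ∧ ((M / q : ℕ) : ℝ) ≤ (M : ℝ) / q := by
    intro q hq
    have hq0 : (0 : ℝ) < q := by exact_mod_cast hq
    refine ⟨?_, Nat.cast_div_le⟩
    have h := Nat.lt_div_mul_add (a := M) hq
    have h' : (M : ℝ) < ((M / q : ℕ) : ℝ) * q + q := by exact_mod_cast h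
    rw [div_le_iff₀ hq0]; linarith
  have hup : ∀ n : ℕ, 1 ≤ n → ∑ m ∈ Icc 1 n, (1 : ℝ) / m ≤ Real.log n + 1 := fun n hn => harmonicSum_le_log_add_one hn
  have hlow : ∀ n : ℕ, Real.log ((n : ℝ) + 1) ≤ ∑ m ∈ Icc 1 n, (1 : ℝ) / m := log_succ_le_harmonicSum
  have h2 := hfl 2 (by norm_num); have h3 := hfl 3 (by norm_num); have h6 := hfl 6 (by norm_num)
  have hM2 : 1 ≤ M / 2 := by omega
  have hM3 : 1 ≤ M / 3 := by omega
  have hM6 : 1 ≤ M / 6 := by omega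
  have hlog6 : Real.log 6 = Real.log 2 + Real.log 3 := by
    rw [show (6 : ℝ) = 2 * 3 by norm_num, Real.log_mul (by norm_num) (by norm_num)]
  -- logs of M/q
  have hl2 : Real.log ((M : ℝ) / 2) = Real.log M - Real.log 2 := Real.log_div hM0.ne' (by norm_num)
  have hl3 : Real.log ((M : ℝ) / 3) = Real.log M - Real.log 3 := Real.log_div hM0.ne' (by norm_num)
  have hl6 : Real.log ((M : ℝ) / 6) = Real.log M - Real.log 6 := Real.log_div hM0.ne' (by norm_num)
  -- upper bounds for H_{M/6} and H_M, lower bounds for H_{M/2}, H_{M/3}; and conversely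
  have uM := hup M (by omega)
  have u6 : ∑ m ∈ Icc 1 (M / 6), (1 : ℝ) / m ≤ Real.log ((M : ℝ) / 6) + 1 :=
    (hup _ hM6).trans (by linarith [Real.log_le_log (by exact_mod_cast hM6 : (0 : ℝ) < ((M / 6 : ℕ) : ℝ)) h6.2])
  have u2 : ∑ m ∈ Icc 1 (M / 2), (1 : ℝ) / m ≤ Real.log ((M : ℝ) / 2) + 1 :=
    (hup _ hM2).trans (by linarith [Real.log_le_log (by exact_mod_cast hM2 : (0 : ℝ) < ((M / 2 : ℕ) : ℝ)) h2.2])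
  have u3 : ∑ m ∈ Icc 1 (M / 3), (1 : ℝ) / m ≤ Real.log ((M : ℝ) / 3) + 1 :=
    (hup _ hM3).trans (by linarith [Real.log_le_log (by exact_mod_cast hM3 : (0 : ℝ) < ((M / 3 : ℕ) : ℝ)) h3.2])
  have lM : Real.log M ≤ ∑ m ∈ Icc 1 M, (1 : ℝ) / m :=
    (Real.log_le_log hM0 (by linarith)).trans (hlow M)
  have l2 : Real.log ((M : ℝ) / 2) ≤ ∑ m ∈ Icc 1 (M / 2), (1 : ℝ) / m :=
    (Real.log_le_log (by positivity) h2.1).trans (hlow _)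
  have l3 : Real.log ((M : ℝ) / 3) ≤ ∑ m ∈ Icc 1 (M / 3), (1 : ℝ) / m :=
    (Real.log_le_log (by positivity) h3.1).trans (hlow _)
  have l6 : Real.log ((M : ℝ) / 6) ≤ ∑ m ∈ Icc 1 (M / 6), (1 : ℝ) / m :=
    (Real.log_le_log (by positivity) h6.1).trans (hlow _)
  rw [abs_le]
  constructor <;> linarith

/-! ### General primes `p ≠ q`: inputs for the K-rung extension -/

/-- `0 ≤ H_M − H_{⌊M/p⌋} ≤ 1 + log p` for `p ≥ 1` (all `M`; `H_n = Σ_{m≤n} 1/m`). -/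
theorem harmonic_sub_harmonic_div_bounds {p : ℕ} (hp : 1 ≤ p) (M : ℕ) :
    0 ≤ (∑ k ∈ Icc 1 M, (1 : ℝ) / k) - ∑ n ∈ Icc 1 (M / p), (1 : ℝ) / n ∧
      (∑ k ∈ Icc 1 M, (1 : ℝ) / k) - ∑ n ∈ Icc 1 (M / p), (1 : ℝ) / n ≤ 1 + Real.log p := by
  have hpR : (1 : ℝ) ≤ p := by exact_mod_cast hp
  have hsub : Icc 1 (M / p) ⊆ Icc 1 M := Finset.Icc_subset_Icc_right (Nat.div_le_self M p)
  have hmono := Finset.sum_le_sum_of_subset_of_nonneg hsub (f := fun k : ℕ => (1 : ℝ) / k)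
    fun k _ _ => by positivity
  refine ⟨by linarith, ?_⟩
  rcases Nat.eq_zero_or_pos M with hM0 | hM
  · subst hM0; simp; linarith [Real.log_nonneg hpR]
  have h1 : ∑ k ∈ Icc 1 M, (1 : ℝ) / k ≤ Real.log M + 1 := harmonicSum_le_log_add_one hM
  have h2 : Real.log (((M / p : ℕ) : ℝ) + 1) ≤ ∑ n ∈ Icc 1 (M / p), (1 : ℝ) / n := log_succ_le_harmonicSum (M / p)
  have hMR : (0 : ℝ) < M := by exact_mod_cast hM
  have hfl : (M : ℝ) / p ≤ ((M / p : ℕ) : ℝ) + 1 := by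
    have h := Nat.lt_div_mul_add (a := M) (show 0 < p by omega)
    have h' : (M : ℝ) < ((M / p : ℕ) : ℝ) * p + p := by exact_mod_cast h
    rw [div_le_iff₀ (by linarith)]
    linarith
  have h3 : Real.log M - Real.log p ≤ Real.log (((M / p : ℕ) : ℝ) + 1) := by
    rw [← Real.log_div hMR.ne' (by linarith)]
    exact Real.log_le_log (by positivity) hfl
  linarith

/-- `⟨φ_p, φ_q⟩_π = (H_M − H_{⌊M/p⌋} − H_{⌊M/q⌋} + H_{⌊M/(pq)⌋})/(pq)` for coprime `p, q ≥ 1`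
(from `φ_pφ_q = 1/(pq) − 𝟙[p|k]/q − 𝟙[q|k]/p + 𝟙[pq|k]`). -/
theorem sum_parityFun_mul_div {p q : ℕ} (hp : 1 ≤ p) (hq : 1 ≤ q) (hpq : Nat.Coprime p q) (M : ℕ) :
    ∑ k ∈ Icc 1 M, parityFun p k * parityFun q k / (k : ℝ) =
      ((∑ k ∈ Icc 1 M, (1 : ℝ) / k) - (∑ n ∈ Icc 1 (M / p), (1 : ℝ) / n)
        - (∑ n ∈ Icc 1 (M / q), (1 : ℝ) / n) + ∑ n ∈ Icc 1 (M / (p * q)), (1 : ℝ) / n) / (p * q) := by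
  have hp0 : (p : ℝ) ≠ 0 := by exact_mod_cast (show p ≠ 0 by omega)
  have hq0 : (q : ℝ) ≠ 0 := by exact_mod_cast (show q ≠ 0 by omega)
  have hdvd : ∀ k, p * q ∣ k ↔ p ∣ k ∧ q ∣ k := fun k =>
    ⟨fun h => ⟨dvd_trans (dvd_mul_right p q) h, dvd_trans (dvd_mul_left q p) h⟩,
     fun h => hpq.mul_dvd_of_dvd_of_dvd h.1 h.2⟩
  have e : ∀ k ∈ Icc 1 M, parityFun p k * parityFun q k / (k : ℝ) =
      (1 / ((p : ℝ) * q)) * (1 / (k : ℝ)) - (1 / (q : ℝ)) * (if p ∣ k then 1 / (k : ℝ) else 0)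
        - (1 / (p : ℝ)) * (if q ∣ k then 1 / (k : ℝ) else 0) + (if p * q ∣ k then 1 / (k : ℝ) else 0) := by
    intro k _
    have ep : parityFun p k = (p : ℝ)⁻¹ - (if p ∣ k then 1 else 0) := by
      by_cases h : p ∣ k
      · rw [parityFun_of_dvd h, if_pos h]; ring
      · rw [parityFun_of_not_dvd h, if_neg h]; ring
    have eq' : parityFun q k = (q : ℝ)⁻¹ - (if q ∣ k then 1 else 0) := by
      by_cases h : q ∣ k
      · rw [parityFun_of_dvd h, if_pos h]; ring
      · rw [parityFun_of_not_dvd h, if_neg h]; ring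
    rw [ep, eq']
    by_cases h1 : p ∣ k
    · by_cases h2 : q ∣ k
      · rw [if_pos h1, if_pos h2, if_pos h1, if_pos h2, if_pos ((hdvd k).2 ⟨h1, h2⟩)]; field_simp; ring
      · rw [if_pos h1, if_neg h2, if_pos h1, if_neg h2, if_neg (fun h => h2 ((hdvd k).1 h).2)]; field_simp; ring
    · by_cases h2 : q ∣ k
      · rw [if_neg h1, if_pos h2, if_neg h1, if_pos h2, if_neg (fun h => h1 ((hdvd k).1 h).1)]; field_simp; ring
      · rw [if_neg h1, if_neg h2, if_neg h1, if_neg h2, if_neg (fun h => h1 ((hdvd k).1 h).1)]; field_simp; ring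
  rw [Finset.sum_congr rfl e]
  simp only [Finset.sum_add_distrib, Finset.sum_sub_distrib, ← Finset.mul_sum, ← Finset.sum_filter]
  have hpq1 : 1 ≤ p * q := Nat.one_le_iff_ne_zero.2 (Nat.mul_ne_zero (by omega) (by omega))
  rw [sum_inv_multiples_eq hp, sum_inv_multiples_eq hq, sum_inv_multiples_eq hpq1]
  push_cast
  field_simp

/-- `|⟨φ_p, φ_q⟩_π| ≤ (1 + log p)/(pq)` for coprime `p, q ≥ 1` and every `M`:
`pq·⟨φ_p,φ_q⟩ = (H_M − H_{⌊M/p⌋}) − (H_{⌊M/q⌋} − H_{⌊⌊M/q⌋/p⌋})`, both brackets in `[0, 1 + log p]`. -/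
theorem abs_sum_parityFun_mul_div_le {p q : ℕ} (hp : 1 ≤ p) (hq : 1 ≤ q) (hpq : Nat.Coprime p q) (M : ℕ) :
    |∑ k ∈ Icc 1 M, parityFun p k * parityFun q k / (k : ℝ)| ≤ (1 + Real.log p) / (p * q) := by
  rw [sum_parityFun_mul_div hp hq hpq, show M / (p * q) = M / q / p by rw [Nat.div_div_eq_div_mul, mul_comm]]
  have h1 := harmonic_sub_harmonic_div_bounds hp M
  have h2 := harmonic_sub_harmonic_div_bounds hp (M / q)
  have hpq0 : (0 : ℝ) < (p : ℝ) * q := by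
    have : (0 : ℝ) < p := by exact_mod_cast (show 0 < p by omega)
    have : (0 : ℝ) < q := by exact_mod_cast (show 0 < q by omega)
    positivity
  rw [abs_div, abs_of_pos hpq0, div_le_div_iff_of_pos_right hpq0, abs_le]
  constructor <;> linarith [h1.1, h1.2, h2.1, h2.2]

/-- `‖φ_p‖²_π ≥ H_M/p²` (`p ≥ 2`). -/
theorem sum_parityFun_sq_div_ge {p : ℕ} (hp : 2 ≤ p) (M : ℕ) :
    (∑ k ∈ Icc 1 M, (1 : ℝ) / k) / (p : ℝ) ^ 2 ≤ ∑ k ∈ Icc 1 M, parityFun p k ^ 2 / (k : ℝ) := by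
  rw [Finset.sum_div]
  refine Finset.sum_le_sum fun k _ => ?_
  have hpR : (2 : ℝ) ≤ p := by exact_mod_cast hp
  have hsq : 1 / (p : ℝ) ^ 2 ≤ parityFun p k ^ 2 := by
    by_cases h : p ∣ k
    · rw [parityFun_of_dvd h]
      -- (1 − 1/p)² ≥ 1/p² since p ≥ 2
      have h1 : (p : ℝ)⁻¹ ≤ 1 - (p : ℝ)⁻¹ := by
        rw [inv_eq_one_div]
        have : 1 / (p : ℝ) ≤ 1 / 2 := one_div_le_one_div_of_le (by norm_num) hpR
        linarith
      calc 1 / (p : ℝ) ^ 2 = ((p : ℝ)⁻¹) ^ 2 := by rw [one_div, inv_pow]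
        _ ≤ (1 - (p : ℝ)⁻¹) ^ 2 := pow_le_pow_left₀ (by positivity) h1 2
        _ = (-(1 - (p : ℝ)⁻¹)) ^ 2 := by ring
    · rw [parityFun_of_not_dvd h, one_div, inv_pow]
  have hk : (0 : ℝ) ≤ 1 / (k : ℝ) := by positivity
  calc 1 / (k : ℝ) / (p : ℝ) ^ 2 = 1 / (p : ℝ) ^ 2 * (1 / (k : ℝ)) := by ring
    _ ≤ parityFun p k ^ 2 * (1 / (k : ℝ)) := mul_le_mul_of_nonneg_right hsq hk
    _ = parityFun p k ^ 2 / (k : ℝ) := by ring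

end Summit.RiemannHypothesis.RiemannHypothesis.Theorems.IntegerScrew

end
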